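import Summits.ValiantsHypothesis.ValiantsHypothesis.Theorems.DepthWindowGrowing
import HarnessLib

/-!
# Route `DepthWindow`, g11 — the SLOPE-GENERIC dial law, ROUTE-INDEPENDENT core
(this module does not import the route file, so that its theorems can serve as the `--glue-by` of a
split of `PerHardLog3`; `DepthWindowSlopeRate.lean` has the same law headed on the route decls
`HomAtSlope p q → HomImmHardAt p q → PerHardLog3`, and `DepthWindowHomSlopeCore.lean` the `7/5`-window
instance used by the gen-2 split)

For EVERY slope `p/q`: homogenisation of constant-product-depth circuits over `ℂ` at slope `p/q`
(product-depth `≤ p·Δ/q + c₀`, size `(s + |σ| + 2)^a · 2^{a d²}`) together with homogeneous hardness of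
`IMM_{m,⌊√log₂ m⌋}` at the same slope (product-depth `≤ p·L₃ m/q + c` forces more than `m^c + c`
gates) gives the crux `PerHardLog3` (the permanent has no polynomial-wire circuits of product-depth
`L₃ n + 1`).  Proof = the g5 core proof with the window hypothesis `5p ≤ 7q` removed (it was only
threaded through).  The instance of record for generation 11 is slope `2` (`perHardLog3_of_two_core`):
the homogenisation half at slope `2` is Limaye–Srinivasan–Tavenas's Lemma 11 (KERNEL in the tree:
`homAtSlope_two_one`, file `DepthWindowHomRelTwoMul.lean`), so the open content of the split
`PerHardLog3 ⇐ HomTwoOne ∧ HomImmHardTwoOne` is the single cell `HomImmHardTwoOne` = "Hard(2)":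
homogeneous circuits of product-depth `2·L₃ m + c` for `IMM_{m,⌊√log₂ m⌋}` are superpolynomial
(print reaches every slope `< 1/log₂ φ = 1.4404…`, Bhargav–Dutta–Saxena 2024; in the tree for every
`25 p ≤ 36 q`).
[cite: LimayeSrinivasanTavenas2025, Lemma 11, Lemma 12, Cor. 4] [cite: BhargavDuttaSaxena2024, Thm. 1.4, Rem. 1.5]
-/

-- layout Summits/ValiantsHypothesis/ValiantsHypothesis forces the duplicated namespace component
set_option linter.dupNamespace false

namespace Summit.ValiantsHypothesis.ValiantsHypothesis.Theorems.DepthWindow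

open MvPolynomial Real Literature.Computability.AlgebraicComplexity ArithCircuit

noncomputable section

/-- **Slope-generic dial law** (route-independent form): homogenisation at slope `p/q` and homogeneous
hardness of `IMM_{m,⌊√log₂ m⌋}` at slope `p/q` give `PerHardLog3` — statements verbatim, no window
hypothesis on `p/q`.
[cite: LimayeSrinivasanTavenas2025, Lemma 11, Lemma 12] [cite: BhargavDuttaSaxena2024, Thm. 1.4, Rem. 1.5] -/
theorem perHardLog3_of_slopeRate_core (p q : ℕ)
    (hHom : ∃ c₀ a : ℕ, ∀ (σ : Type) [Fintype σ] (d : ℕ) (f : MvPolynomial σ ℂ),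
      f.IsHomogeneous d → ∀ D : ArithCircuit ℂ σ, D.Computes f → ∃ D' : ArithCircuit ℂ σ,
        D'.Computes f ∧ (∀ g ∈ ArithCircuit.gateValues D'.gates, ∃ e : ℕ, g.IsHomogeneous e) ∧
        D'.productDepth ≤ p * D.productDepth / q + c₀ ∧
        D'.size ≤ (D.size + Fintype.card σ + 2) ^ a * 2 ^ (a * d * d))
    (hHard : ∀ c : ℕ, ∃ m₀ : ℕ, ∀ m : ℕ, m₀ ≤ m →
      ∀ D : ArithCircuit ℂ (Fin (Nat.sqrt (Nat.log 2 m)) × Fin m × Fin m),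
        (∀ g ∈ ArithCircuit.gateValues D.gates, ∃ e : ℕ, g.IsHomogeneous e) →
        D.Computes (immPoly m (Nat.sqrt (Nat.log 2 m)) ℂ) →
        D.productDepth ≤ p * Nat.log 2 (Nat.log 2 (Nat.log 2 m)) / q + c → m ^ c + c < D.size) :
    ¬ ∃ c : ℕ, ∀ n : ℕ, ∃ C : ArithCircuit ℂ (Fin n × Fin n), C.Computes (perPoly (Fin n) ℂ) ∧
      C.productDepth ≤ Nat.log 2 (Nat.log 2 (Nat.log 2 n)) + 1 ∧ C.edgeSize ≤ n ^ c + c := by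
  classical
  rintro ⟨c, hc⟩
  -- arithmetic helpers (local copies, as in `DepthWindowHomSlopeCore.lean`)
  have hpow2 : ∀ a m : ℕ, 2 ^ (a * Nat.sqrt (Nat.log 2 m) * Nat.sqrt (Nat.log 2 m)) ≤ m ^ a + a := by
    intro a m
    rcases Nat.eq_zero_or_pos m with rfl | hm
    · rcases a with _ | a <;> simp
    · calc 2 ^ (a * Nat.sqrt (Nat.log 2 m) * Nat.sqrt (Nat.log 2 m)) ≤ 2 ^ (a * Nat.log 2 m) := by
            refine Nat.pow_le_pow_right (by norm_num) ?_
            rw [mul_assoc]; exact Nat.mul_le_mul_left a (Nat.sqrt_le _)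
        _ = (2 ^ Nat.log 2 m) ^ a := by rw [mul_comm, pow_mul]
        _ ≤ m ^ a := Nat.pow_le_pow_left (Nat.pow_log_le_self 2 hm.ne') a
        _ ≤ m ^ a + a := Nat.le_add_right _ _
  have hslope : ∀ p q Y : ℕ, p * (Y + 2) / q ≤ p * Y / q + 2 * p := by
    intro p q Y
    rcases Nat.eq_zero_or_pos q with rfl | hq
    · simp
    · calc p * (Y + 2) / q = (p * Y + 2 * p) / q := by ring_nf
        _ ≤ (p * Y + 2 * p * q) / q :=
            Nat.div_le_div_right (Nat.add_le_add_left (Nat.le_mul_of_pos_right _ hq) _)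
        _ = p * Y / q + 2 * p := Nat.add_mul_div_right _ _ hq
  -- the degree function `d(m) = ⌊√⌊log₂ m⌋⌋ ≤ m`
  let dd : ℕ → ℕ := fun m => Nat.sqrt (Nat.log 2 m)
  have hdd_le : ∀ m, dd m ≤ m := fun m => (Nat.sqrt_le_self _).trans (Nat.log_le_self 2 m)
  -- the IMM family and its renaming to `Fin (v m)` variables
  let v : ℕ → ℕ := fun m => Fintype.card (Fin (dd m) × Fin m × Fin m)
  let e : ∀ m, (Fin (dd m) × Fin m × Fin m) ≃ Fin (v m) := fun m => Fintype.equivFin _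
  let G : ∀ m, MvPolynomial (Fin (dd m) × Fin m × Fin m) ℂ := fun m => immPoly m (dd m) ℂ
  let G' : ∀ m, MvPolynomial (Fin (v m)) ℂ := fun m => renameEquiv ℂ (e m) (G m)
  have hv : ∀ m, Fintype.card (Fin (dd m) × Fin m × Fin m) ≤ m ^ 3 + 3 := fun m => by
    simp only [Fintype.card_prod, Fintype.card_fin]
    calc dd m * (m * m) ≤ m * (m * m) := Nat.mul_le_mul_right _ (hdd_le m)
      _ = m ^ 3 := by ring
      _ ≤ m ^ 3 + 3 := Nat.le_add_right _ _
  have hG : IsVPFamily G := by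
    refine ⟨⟨⟨3, fun m => hv m⟩, ⟨1, fun m => ?_⟩⟩, ⟨6, fun m => ?_⟩⟩
    · show (immPoly m (dd m) ℂ).totalDegree ≤ m ^ 1 + 1
      refine ((immPoly_isHomogeneous_holds (k := ℂ) m (dd m)).totalDegree_le).trans ?_
      rw [pow_one]; exact (hdd_le m).trans (Nat.le_succ m)
    · show complexity (immPoly m (dd m) ℂ) ≤ m ^ 6 + 6
      calc complexity (immPoly m (dd m) ℂ) ≤ m + 2 * m ^ 3 * dd m := complexity_immPoly_le ℂ m (dd m)
        _ ≤ m ^ 1 + 2 * (m ^ 1) ^ 3 * m := by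
            rw [pow_one]; exact Nat.add_le_add_left (Nat.mul_le_mul_left _ (hdd_le m)) _
        _ ≤ m ^ (3 * 1 + 3) + (3 * 1 + 3) := imm_cost_le 1 m
        _ = m ^ 6 + 6 := by norm_num
  have hG' : IsVPFamily G' := (isVPFamily_renameEquiv_iff e G).2 hG
  have hG'N : IsVNPFamily G' := IsVPFamily.isVNPFamily_holds' hG'
  -- VNP-completeness of the permanent over `ℂ`: `G'` is a p-projection of `per`
  obtain ⟨t, ht, hproj⟩ := (isVNPComplete_perPoly_holds ℂ ringChar_complex_ne_two).2 v G' hG'N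
  obtain ⟨b, hb⟩ : IsPBounded fun m => t m ^ c + c :=
    IsPBounded.comp_holds (s := fun N => N ^ c + c) ⟨c, fun N => le_rfl⟩ ht
  obtain ⟨a, ha⟩ := ht
  -- few-gate circuits for `G m = IMM_{m, dd m}`, of product-depth `≤ ⌊log₂log₂log₂ (t m)⌋ + 1`
  have key : ∀ m, ∃ D : ArithCircuit ℂ (Fin (dd m) × Fin m × Fin m),
      D.Computes (G m) ∧ D.productDepth ≤ Nat.log 2 (Nat.log 2 (Nat.log 2 (t m))) + 1 ∧
        D.size ≤ m ^ b + b := by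
    intro m
    obtain ⟨C, hCc, hCd, hCe⟩ := hc (t m)
    obtain ⟨D', hD'c, hD'd, hD'e, -⟩ := exists_circuit_of_isProjection (hproj m) C hCc
    have hGm : MvPolynomial.rename (e m).symm (G' m) = G m := by
      show MvPolynomial.rename (e m).symm (renameEquiv ℂ (e m) (G m)) = G m
      rw [renameEquiv_apply, rename_rename, (e m).symm_comp_self, rename_id_apply]
    obtain ⟨D, hDe, hDd, hDw, hDs⟩ := exists_size_le_edgeSize (D'.rename (e m).symm)
    refine ⟨D, ?_, ?_, ?_⟩
    · rw [Computes, hDe, ← hGm]; exact hD'c.rename (e m).symm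
    · exact hDd.trans ((DepthThreeChasm.productDepth_rename _ _).le.trans (hD'd.trans hCd))
    · calc D.size ≤ D.edgeSize := hDs
        _ ≤ (D'.rename (e m).symm).edgeSize := hDw
        _ = D'.edgeSize := DepthThreeChasm.edgeSize_rename _ _
        _ ≤ C.edgeSize := hD'e
        _ ≤ t m ^ c + c := hCe
        _ ≤ m ^ b + b := hb m
  -- homogenise at the IMM level at slope `p/q`: size still polynomial in `m`
  obtain ⟨c₀, a₁, hhom⟩ := hHom
  obtain ⟨b', hb'⟩ : IsPBounded fun m => (m ^ b + b + (m ^ 3 + 3) + 2) ^ a₁ * (m ^ a₁ + a₁) :=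
    IsPBounded.mul_holds
      (IsPBounded.pow_holds (IsPBounded.add_holds (IsPBounded.add_holds
        ⟨b, fun m => le_rfl⟩ ⟨3, fun m => le_rfl⟩) (IsPBounded.const 2)) a₁)
      ⟨a₁, fun m => le_rfl⟩
  have keyH : ∀ m, ∃ D : ArithCircuit ℂ (Fin (dd m) × Fin m × Fin m),
      (∀ g ∈ ArithCircuit.gateValues D.gates, ∃ e : ℕ, g.IsHomogeneous e) ∧ D.Computes (G m) ∧
        D.productDepth ≤ p * (Nat.log 2 (Nat.log 2 (Nat.log 2 (t m))) + 1) / q + c₀ ∧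
        D.size ≤ m ^ b' + b' := by
    intro m
    obtain ⟨D, hDc, hDd, hDs⟩ := key m
    obtain ⟨D', hD'c, hD'h, hD'd, hD's⟩ :=
      hhom _ (dd m) (G m) (immPoly_isHomogeneous_holds (k := ℂ) m (dd m)) D hDc
    refine ⟨D', hD'h, hD'c, hD'd.trans ?_, hD's.trans ((?_ : _ ≤ _).trans (hb' m))⟩
    · exact Nat.add_le_add_right (Nat.div_le_div_right (Nat.mul_le_mul_left p hDd)) _
    · exact Nat.mul_le_mul (Nat.pow_le_pow_left (by have := hv m; omega) _)
        (hpow2 a₁ m)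
  -- the homogeneous hardness at slope `p/q` and exponent `c' = 2p + c₀ + b' + 1`, from `m₀` on
  obtain ⟨m₀, hm₀⟩ := hHard (2 * p + c₀ + b' + 1)
  -- evaluate at the tower `m = 2^(2^(2^Y))` with `Y ≥ m₀` and `a + 1 ≤ 2 ^ Y`
  obtain ⟨Y, hYa, hYm⟩ : ∃ Y : ℕ, a + 1 ≤ 2 ^ Y ∧ m₀ ≤ Y := by
    refine ⟨a + m₀ + 1, ?_, by omega⟩
    have : a + m₀ + 1 < 2 ^ (a + m₀ + 1) := Nat.lt_two_pow_self
    omega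
  set m : ℕ := 2 ^ (2 ^ (2 ^ Y)) with hm
  have hYm' : m₀ ≤ m := by
    have h1 : Y < 2 ^ Y := Nat.lt_two_pow_self
    have h2 : 2 ^ Y < 2 ^ (2 ^ Y) := Nat.pow_lt_pow_right (by norm_num) h1
    have h3 : 2 ^ (2 ^ Y) < 2 ^ (2 ^ (2 ^ Y)) := Nat.pow_lt_pow_right (by norm_num) h2
    omega
  have hm2 : 2 ≤ m := by
    have : 1 ≤ 2 ^ (2 ^ Y) := Nat.one_le_two_pow
    calc 2 = 2 ^ 1 := by norm_num
      _ ≤ 2 ^ (2 ^ (2 ^ Y)) := Nat.pow_le_pow_right (by norm_num) this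
  have hL3m : Nat.log 2 (Nat.log 2 (Nat.log 2 m)) = Y := log3_tower Y
  have hL3t : Nat.log 2 (Nat.log 2 (Nat.log 2 (t m))) ≤ Y + 1 :=
    log3_le_of_le_tower_pow Y a (t m) hYa (ha m)
  obtain ⟨D, hDh, hDc, hDd, hDs⟩ := keyH m
  have hdepth : D.productDepth ≤ p * Nat.log 2 (Nat.log 2 (Nat.log 2 m)) / q + (2 * p + c₀ + b' + 1) := by
    rw [hL3m]
    have h1 : p * (Nat.log 2 (Nat.log 2 (Nat.log 2 (t m))) + 1) / q ≤ p * (Y + 2) / q :=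
      Nat.div_le_div_right (Nat.mul_le_mul_left p (by omega))
    have h2 := hslope p q Y
    omega
  have hlt := hm₀ m hYm' D hDh hDc hdepth
  -- `m ^ c' + c' < D.size ≤ m ^ b' + b'` with `b' ≤ c'`: absurd
  have hmono : m ^ b' + b' ≤ m ^ (2 * p + c₀ + b' + 1) + (2 * p + c₀ + b' + 1) :=
    Nat.add_le_add (Nat.pow_le_pow_right (by omega) (by omega)) (by omega)
  omega


/-- **The slope-2 instance** (generation 11's split of `PerHardLog3`): `HomTwoOne → HomImmHardTwoOne →
PerHardLog3`, statements verbatim (`HomTwoOne` = LST Lemma 11, kernel `homAtSlope_two_one`;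
`HomImmHardTwoOne` = "Hard(2)", the open cell).
[cite: LimayeSrinivasanTavenas2025, Lemma 11, Cor. 4] [cite: BhargavDuttaSaxena2024, Thm. 1.4] -/
theorem perHardLog3_of_two_core
    (hHom : ∃ c₀ a : ℕ, ∀ (σ : Type) [Fintype σ] (d : ℕ) (f : MvPolynomial σ ℂ),
      f.IsHomogeneous d → ∀ D : ArithCircuit ℂ σ, D.Computes f → ∃ D' : ArithCircuit ℂ σ,
        D'.Computes f ∧ (∀ g ∈ ArithCircuit.gateValues D'.gates, ∃ e : ℕ, g.IsHomogeneous e) ∧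
        D'.productDepth ≤ 2 * D.productDepth / 1 + c₀ ∧
        D'.size ≤ (D.size + Fintype.card σ + 2) ^ a * 2 ^ (a * d * d))
    (hHard : ∀ c : ℕ, ∃ m₀ : ℕ, ∀ m : ℕ, m₀ ≤ m →
      ∀ D : ArithCircuit ℂ (Fin (Nat.sqrt (Nat.log 2 m)) × Fin m × Fin m),
        (∀ g ∈ ArithCircuit.gateValues D.gates, ∃ e : ℕ, g.IsHomogeneous e) →
        D.Computes (immPoly m (Nat.sqrt (Nat.log 2 m)) ℂ) →
        D.productDepth ≤ 2 * Nat.log 2 (Nat.log 2 (Nat.log 2 m)) / 1 + c → m ^ c + c < D.size) :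
    ¬ ∃ c : ℕ, ∀ n : ℕ, ∃ C : ArithCircuit ℂ (Fin n × Fin n), C.Computes (perPoly (Fin n) ℂ) ∧
      C.productDepth ≤ Nat.log 2 (Nat.log 2 (Nat.log 2 n)) + 1 ∧ C.edgeSize ≤ n ^ c + c :=
  perHardLog3_of_slopeRate_core 2 1 hHom hHard

/-- **The slope-2 instance, hardness hypothesis first** (the order in which the gate renders the
resplit family: crux `HomImmHardTwoOne`, then support `HomTwoOne`). -/
theorem perHardLog3_of_hardTwo_homTwo_core
    (hHard : ∀ c : ℕ, ∃ m₀ : ℕ, ∀ m : ℕ, m₀ ≤ m →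
      ∀ D : ArithCircuit ℂ (Fin (Nat.sqrt (Nat.log 2 m)) × Fin m × Fin m),
        (∀ g ∈ ArithCircuit.gateValues D.gates, ∃ e : ℕ, g.IsHomogeneous e) →
        D.Computes (immPoly m (Nat.sqrt (Nat.log 2 m)) ℂ) →
        D.productDepth ≤ 2 * Nat.log 2 (Nat.log 2 (Nat.log 2 m)) / 1 + c → m ^ c + c < D.size)
    (hHom : ∃ c₀ a : ℕ, ∀ (σ : Type) [Fintype σ] (d : ℕ) (f : MvPolynomial σ ℂ),
      f.IsHomogeneous d → ∀ D : ArithCircuit ℂ σ, D.Computes f → ∃ D' : ArithCircuit ℂ σ,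
        D'.Computes f ∧ (∀ g ∈ ArithCircuit.gateValues D'.gates, ∃ e : ℕ, g.IsHomogeneous e) ∧
        D'.productDepth ≤ 2 * D.productDepth / 1 + c₀ ∧
        D'.size ≤ (D.size + Fintype.card σ + 2) ^ a * 2 ^ (a * d * d)) :
    ¬ ∃ c : ℕ, ∀ n : ℕ, ∃ C : ArithCircuit ℂ (Fin n × Fin n), C.Computes (perPoly (Fin n) ℂ) ∧
      C.productDepth ≤ Nat.log 2 (Nat.log 2 (Nat.log 2 n)) + 1 ∧ C.edgeSize ≤ n ^ c + c :=
  perHardLog3_of_slopeRate_core 2 1 hHom hHard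

end

end Summit.ValiantsHypothesis.ValiantsHypothesis.Theorems.DepthWindow
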